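import Summits.ABC.IUTFork.DAGL2p
import Summits.ABC.IUTFork.DAGL2r
import Summits.ABC.IUTFork.DAGRd

/-!
# Kernel DAG index — witness UPGRADE part za (GENERATED by abc-iut-c312-2 gen 7 `work/gen_index.py upgrade` @2026-08-27T06:11Z from HOME/plan/DAG.tsv
(regenerated 2026-08-27T06:08:12Z); spec v1.3 §2(c) "`_holds` iff the DAG row is discharged", §5 "re-file when nodes change status")

THIS FILE PROVES NOTHING NEW AND ASSERTS NOTHING. For 4 nodes ALREADY INDEXED with a partial witness `N_<id>_part` (their DAG row was
`landed(p…)` when indexed) whose row is NOW `discharged(p…)`, it adds the discharge witness `N_<id>_holds : N_<id> := N_<id>_part` BY NAME —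
the node statement `N_<id>` is untouched (append-only across files: nothing landed is redefined). Nothing here says abc is proved or refuted
or takes a side on [IUTchIII] Cor 3.12. typed ≠ discharged; indexed ≠ endorsed.
-/

namespace Summit.ABC.IUTFork.DAG

/-- [node EtTh:Prop1.3 · L2/D1 · DAG status discharged(p497657+p498377+p499863)] discharge witness of `N_EtTh_Prop1_3` (indexed in `DAGL2p` with `_part` while the row was landed; now discharged, p497657): BY NAME; proves nothing new. -/
theorem N_EtTh_Prop1_3_holds : N_EtTh_Prop1_3 := N_EtTh_Prop1_3_part

/-- [node EtTh:Cor2.18(iv) · L2/D1 · DAG status discharged(p502501)] discharge witness of `N_EtTh_Cor2_18_iv` (indexed in `DAGL2r` with `_part` while the row was landed; now discharged, p502501): BY NAME; proves nothing new. -/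
theorem N_EtTh_Cor2_18_iv_holds : N_EtTh_Cor2_18_iv := N_EtTh_Cor2_18_iv_part

/-- [node EtTh:Cor2.19(ii) · L2/D1 · DAG status discharged(p502501)] discharge witness of `N_EtTh_Cor2_19_ii'` (indexed in `DAGRd` with `_part` while the row was landed; now discharged, p502501): BY NAME; proves nothing new. -/
theorem N_EtTh_Cor2_19_ii'_holds : N_EtTh_Cor2_19_ii' := N_EtTh_Cor2_19_ii'_part

/-- [node EtTh:Cor2.19(iii) · L2/D1 · DAG status discharged(p467752+p408806)] discharge witness of `N_EtTh_Cor2_19_iii'` (indexed in `DAGRd` with `_part` while the row was landed; now discharged, p467752): BY NAME; proves nothing new. -/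
theorem N_EtTh_Cor2_19_iii'_holds : N_EtTh_Cor2_19_iii' := N_EtTh_Cor2_19_iii'_part

end Summit.ABC.IUTFork.DAG
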